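import Literature.NumberTheory.PAdicHodge.HodgeTateRing
import Literature.NumberTheory.GaloisRepresentations.PAdicHodge
import Mathlib.Algebra.Ring.Action.Field
import HarnessLib

/-!
# `B_HT(F)` is a period ring: Fontaine's regularity and the `PeriodRingData`

Continuation of `HodgeTateRing` (`B_HT(F) = ℂ_F[T;T⁻¹]` with `σ(c Tⁿ) = σ(c) χ_F(σ)ⁿ Tⁿ`). Using
Ax–Sen–Tate (`CompletedAlgClosure.fixedPoints_eq_range_algebraMap`: `ℂ_F^{Γ_F} = F`) and Tate's
theorem (`CompletedAlgClosure.eq_zero_of_forall_smul_eq_cyclotomicCharacter_zpow`: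
`ℂ_F(χ^j)^{Γ_F} = 0`, `j ≠ 0`) we prove Fontaine's three regularity conditions for the
`(ℚ_p, Γ_F)`-ring `B_HT(F)` (Fontaine 1994, Exp. III §1.4–1.5; Fontaine–Ouyang §2.12–2.13, §5.1):

* (i) `HT.invariants_eq` : `B_HT^{Γ_F} = F` (coefficientwise: `b_n ∈ ℂ_F(χ^{-n})^{Γ_F}`);
* (ii) `HT.exists_smul_eq` : if `c ≠ 0` and `σ(b) c = b σ(c)` for all `σ` (`b/c ∈ (Frac B_HT)^{Γ_F}`)
  then `b ∈ F c` — the KEY LEMMA `HT.eq_and_exists_of_smul_rel` compares top coefficients: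
  `σ(u) χ(σ)^a w = u σ(w) χ(σ)^k` forces `a = k` (Tate) and `u/w ∈ F` (Ax–Sen–Tate), and then
  `b - e c`, which satisfies the same relation but is supported strictly below `top c`, vanishes;
* (iii) `HT.isUnit_of_smul_eq_algebraMap_mul` : a non-zero `b` spanning a `Γ_F`-stable `F`-line is a
  monomial `β T^a`, hence a unit;

and package everything as **`hodgeTatePeriodRingData hp : PeriodRingData (absoluteGaloisGroup F) ℚ_[p] F`**
— the first genuine (non-truncated) instance of the tree's period-ring interface (`PAdicHodge.lean`),
`B_HT = gr B_dR`, whose admissible representations are the Hodge–Tate ones.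

## References

* J.-M. Fontaine, *Le corps des périodes p-adiques* / *Représentations p-adiques semi-stables*,
  Astérisque 223 (1994), Exp. II §1.5.5, Exp. III §1.4–§1.5. [FontaineAsterisque223III]
* J.-M. Fontaine, Y. Ouyang, *Theory of p-adic Galois representations*, §2.12–2.13 (regular
  `(F, G)`-rings), §5.1 (`B_HT`). [FontaineOuyang2022]
* J. Tate, *p-divisible groups* (1967), §3.3 Theorem 2. [Tate1967]
-/

noncomputable section

open ValuativeRel Field UniformSpace LaurentPolynomial

open scoped Pointwise

namespace Literature.NumberTheory.PAdicHodge

open Literature.NumberTheory.GaloisRepresentations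
open Literature.NumberTheory.GaloisRepresentations.IsNonarchimedeanLocalField

variable {F : Type} [Field F] [ValuativeRel F] [TopologicalSpace F] [IsNonarchimedeanLocalField F]
  {p : ℕ}

namespace HT

variable (hp : valuation F p < 1) [CharZero F] [Fact p.Prime]

/-! ### Coefficients of sums and products; the top exponent -/

omit [CharZero F] [Fact p.Prime] in
/-- Coefficients commute with finite sums. [folklore] -/
theorem coeff_finset_sum {ι : Type*} (s : Finset ι) (g : ι → HT hp) (n : ℤ) :
    coeff hp (∑ i ∈ s, g i) n = ∑ i ∈ s, coeff hp (g i) n := by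
  classical
  induction s using Finset.induction_on with
  | empty => rw [Finset.sum_empty, Finset.sum_empty, coeff_zero]
  | insert a s ha ih => rw [Finset.sum_insert ha, Finset.sum_insert ha, coeff_add, ih]

omit [CharZero F] [Fact p.Prime] in
/-- **Product formula at the top**: if `support f ⊆ (-∞, a]` and `support g ⊆ (-∞, k]` then
`(f g)_{a+k} = f_a g_k`. [folklore] -/
theorem coeff_mul_of_support_le {f g : HT hp} {a k : ℤ} (hf : ∀ m ∈ support hp f, m ≤ a)
    (hg : ∀ l ∈ support hp g, l ≤ k) : coeff hp (f * g) (a + k) = coeff hp f a * coeff hp g k := by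
  classical
  have hfg : f * g = ∑ m ∈ support hp f, ∑ l ∈ support hp g, mono hp (coeff hp f m * coeff hp g l) (m + l) := by
    conv_lhs => rw [← sum_mono_coeff hp f, ← sum_mono_coeff hp g]
    rw [Finset.sum_mul_sum]
    refine Finset.sum_congr rfl fun m _ => Finset.sum_congr rfl fun l _ => ?_
    exact mono_mul_mono hp _ _ _ _
  rw [hfg, coeff_finset_sum]
  simp only [coeff_finset_sum, coeff_mono]
  -- only the pair `(a, k)` contributes
  by_cases ha : a ∈ support hp f
  · rw [Finset.sum_eq_single a]
    · by_cases hk : k ∈ support hp g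
      · rw [Finset.sum_eq_single k]
        · rw [if_pos rfl]
        · intro l hl hlk
          rw [if_neg]; intro h; exact hlk (by omega)
        · intro h; exact absurd hk h
      · rw [Finset.sum_eq_zero]
        · rw [show coeff hp g k = 0 from not_not.mp ((mem_support_iff hp).not.mp hk), mul_zero]
        · intro l hl
          rw [if_neg]; intro h
          have := hg l hl
          have hlk : l = k := by omega
          exact hk (hlk ▸ hl)
    · intro m hm hma
      refine Finset.sum_eq_zero fun l hl => ?_
      rw [if_neg]; intro h
      have := hf m hm; have := hg l hl
      exact hma (by omega)
    · intro h; exact absurd ha h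
  · rw [show coeff hp f a = 0 from not_not.mp ((mem_support_iff hp).not.mp ha), zero_mul]
    refine Finset.sum_eq_zero fun m hm => Finset.sum_eq_zero fun l hl => ?_
    rw [if_neg]; intro h
    have := hf m hm; have := hg l hl
    have hma : m = a := by omega
    exact ha (hma ▸ hm)

omit [CharZero F] [Fact p.Prime] in
/-- `f = 0 ↔ support f = ∅`. [folklore] -/
theorem support_eq_empty_iff {f : HT hp} : support hp f = ∅ ↔ f = 0 := by
  constructor
  · intro h
    exact ext hp fun n => by
      rw [coeff_zero]
      by_contra hne
      have := (mem_support_iff hp).mpr hne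
      rw [h] at this; exact absurd this (Finset.notMem_empty n)
  · rintro rfl; rfl

omit [CharZero F] [Fact p.Prime] in
/-- The support of a non-zero element is nonempty. [folklore] -/
theorem support_nonempty {f : HT hp} (hf : f ≠ 0) : (support hp f).Nonempty :=
  Finset.nonempty_iff_ne_empty.mpr fun h => hf ((support_eq_empty_iff hp).mp h)

/-- **The top exponent** of a non-zero element of `B_HT`. [folklore] -/
def top {f : HT hp} (hf : f ≠ 0) : ℤ := (support hp f).max' (support_nonempty hp hf)

omit [CharZero F] [Fact p.Prime] in
/-- Exponents in the support are `≤ top`. [folklore] -/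
theorem le_top_of_mem_support {f : HT hp} (hf : f ≠ 0) {m : ℤ} (hm : m ∈ support hp f) : m ≤ top hp hf :=
  Finset.le_max' _ m hm

omit [CharZero F] [Fact p.Prime] in
/-- The top coefficient is non-zero. [folklore] -/
theorem coeff_top_ne_zero {f : HT hp} (hf : f ≠ 0) : coeff hp f (top hp hf) ≠ 0 :=
  (mem_support_iff hp).mp (Finset.max'_mem _ _)

/-- `top (σ • f) = top f`. [folklore] -/
theorem top_smul (σ : absoluteGaloisGroup F) {f : HT hp} (hf : f ≠ 0) (hσf : σ • f ≠ 0) :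
    top hp hσf = top hp hf := by
  unfold top; congr 1; exact support_smul hp σ f

/-- `σ • f ≠ 0` for `f ≠ 0`. [folklore] -/
theorem smul_ne_zero' (σ : absoluteGaloisGroup F) {f : HT hp} (hf : f ≠ 0) : σ • f ≠ 0 := by
  intro h; apply hf
  have := congrArg (fun g => σ⁻¹ • g) h
  simpa only [inv_smul_smul, smul_zero] using this

omit [CharZero F] [Fact p.Prime] in
/-- Support of `a T⁰ · f` is contained in that of `f`. [folklore] -/
theorem support_mono_zero_mul_subset (c : CompletedAlgClosure F) (f : HT hp) :
    support hp (mono hp c 0 * f) ⊆ support hp f := by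
  intro n hn
  rw [mem_support_iff, coeff_mono_zero_mul] at hn
  exact (mem_support_iff hp).mpr (right_ne_zero_of_mul hn)

/-! ### Tate's theorem in `twist` form -/

/-- Tate: `σ • x = χ(σ)^j x` for all `σ` with `j ≠ 0` forces `x = 0`. [cite: Tate1967, §3.3 Theorem 2] -/
theorem eq_zero_of_smul_eq_twist_zpow_mul {j : ℤ} (hj : j ≠ 0) {x : CompletedAlgClosure F}
    (hx : ∀ σ : absoluteGaloisGroup F, σ • x = twist hp σ ^ j * x) : x = 0 :=
  CompletedAlgClosure.eq_zero_of_forall_smul_eq_cyclotomicCharacter_zpow hp hj hx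

/-- **Comparison of twisted eigen-coefficients** (the key use of Tate's theorem): if
`σ • u * χ(σ)^a * w = u * (σ • w * χ(σ)^k)` for all `σ ∈ Γ_F` with `u, w ≠ 0`, then `a = k` and
`u = e w` for some `e ∈ F` (the quotient `u/w` spans a `Γ_F`-line of character `χ^{k-a}`, which is
`0` unless `k = a` by Tate, and then `u/w ∈ ℂ_F^{Γ_F} = F` by Ax–Sen–Tate).
[cite: Tate1967, §3.3 Theorem 2] [cite: FontaineOuyang2022, §5.1] -/
theorem eq_and_exists_of_smul_rel {u w : CompletedAlgClosure F} (hu : u ≠ 0) (hw : w ≠ 0) {a k : ℤ}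
    (h : ∀ σ : absoluteGaloisGroup F, σ • u * twist hp σ ^ a * w = u * (σ • w * twist hp σ ^ k)) :
    a = k ∧ ∃ e : F, u = algebraMap F (CompletedAlgClosure F) e * w := by
  set x : CompletedAlgClosure F := u / w with hxdef
  have hx0 : x ≠ 0 := div_ne_zero hu hw
  have hx : ∀ σ : absoluteGaloisGroup F, σ • x = twist hp σ ^ (k - a) * x := by
    intro σ
    have ht : twist hp σ ≠ 0 := twist_ne_zero hp σ
    have hσw : σ • w ≠ 0 := fun h0 => hw (by simpa using congrArg (fun y => σ⁻¹ • y) h0)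
    have h1 : σ • x = σ • u / σ • w := by rw [hxdef, div_eq_mul_inv, smul_mul', smul_inv'', ← div_eq_mul_inv]
    rw [h1, zpow_sub₀ ht, hxdef, div_mul_div_comm,
      div_eq_div_iff hσw (mul_ne_zero (zpow_ne_zero a ht) hw)]
    linear_combination h σ
  have hak : a = k := by
    by_contra hne
    exact hx0 (eq_zero_of_smul_eq_twist_zpow_mul hp (sub_ne_zero.mpr (Ne.symm hne)) hx)
  refine ⟨hak, ?_⟩
  have hfix : x ∈ {y : CompletedAlgClosure F | ∀ σ : absoluteGaloisGroup F, σ • y = y} := by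
    intro σ; rw [hx σ, hak, sub_self, zpow_zero, one_mul]
  rw [CompletedAlgClosure.fixedPoints_eq_range_algebraMap] at hfix
  obtain ⟨e, he⟩ := hfix
  exact ⟨e, by rw [he, hxdef, div_mul_cancel₀ u hw]⟩

/-! ### Fontaine's regularity (ii): `(Frac B_HT)^{Γ_F} = B_HT^{Γ_F}` -/

/-- **Top comparison**: if `σ(b) c = b σ(c)` for all `σ` with `b, c ≠ 0`, then `top b = top c` and
the top coefficients satisfy `b_{top} = e c_{top}` with `e ∈ F`. [cite: FontaineAsterisque223III, Exp. III §1.4] -/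
theorem top_eq_of_rel {b c : HT hp} (hb : b ≠ 0) (hc : c ≠ 0)
    (h : ∀ σ : absoluteGaloisGroup F, σ • b * c = b * σ • c) :
    top hp hb = top hp hc ∧ ∃ e : F, coeff hp b (top hp hb) =
      algebraMap F (CompletedAlgClosure F) e * coeff hp c (top hp hc) := by
  set a := top hp hb with hadef
  set k := top hp hc with hkdef
  have hrel : ∀ σ : absoluteGaloisGroup F,
      σ • coeff hp b a * twist hp σ ^ a * coeff hp c k = coeff hp b a * (σ • coeff hp c k * twist hp σ ^ k) := by
    intro σ
    have h1 : coeff hp (σ • b * c) (a + k) = coeff hp (σ • b) a * coeff hp c k :=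
      coeff_mul_of_support_le hp (fun m hm => le_top_of_mem_support hp hb (by rwa [support_smul] at hm))
        (fun l hl => le_top_of_mem_support hp hc hl)
    have h2 : coeff hp (b * σ • c) (a + k) = coeff hp b a * coeff hp (σ • c) k :=
      coeff_mul_of_support_le hp (fun m hm => le_top_of_mem_support hp hb hm)
        (fun l hl => le_top_of_mem_support hp hc (by rwa [support_smul] at hl))
    rw [← coeff_smul, ← coeff_smul, ← h1, ← h2, h σ]
  exact eq_and_exists_of_smul_rel hp (coeff_top_ne_zero hp hb) (coeff_top_ne_zero hp hc) hrel

/-- **Fontaine's regularity (ii) for `B_HT`**: if `c ≠ 0` and `σ(b) c = b σ(c)` for all `σ ∈ Γ_F`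
(i.e. `b/c ∈ (Frac B_HT)^{Γ_F}`), then `b = e c` for some `e ∈ F`. Proof: by the top comparison
`b - e c` (same relation, supported strictly below `top c`) must vanish.
[cite: FontaineAsterisque223III, Exp. III §1.4 and §1.5] [cite: FontaineOuyang2022, §5.1] -/
theorem exists_smul_eq (b c : HT hp) (hc : c ≠ 0)
    (h : ∀ σ : absoluteGaloisGroup F, σ • b * c = b * σ • c) : ∃ e : F, b = e • c := by
  by_cases hb : b = 0
  · exact ⟨0, by rw [hb, zero_smul]⟩
  obtain ⟨hak, e, he⟩ := top_eq_of_rel hp hb hc h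
  refine ⟨e, ?_⟩
  -- `b' = b - e • c` satisfies the relation and is supported below `top b`
  set b' := b - e • c with hb'def
  have h' : ∀ σ : absoluteGaloisGroup F, σ • b' * c = b' * σ • c := by
    intro σ
    rw [hb'def, smul_sub, smul_comm σ e c, sub_mul, sub_mul, smul_mul_assoc e (σ • c) c,
      smul_mul_assoc e c (σ • c), h σ, mul_comm c (σ • c)]
  by_contra hne
  have hb'0 : b' ≠ 0 := fun h0 => hne (sub_eq_zero.mp h0)
  have hsupp : ∀ m ∈ support hp b', m < top hp hb := by
    intro m hm
    rw [mem_support_iff, hb'def, coeff_sub, coeff_base_smul] at hm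
    by_contra hle
    push Not at hle
    rcases hle.lt_or_eq with hlt | heq
    · apply hm
      have h1 : coeff hp b m = 0 := by
        by_contra h1; exact (not_le.mpr hlt) (le_top_of_mem_support hp hb ((mem_support_iff hp).mpr h1))
      have h2 : coeff hp c m = 0 := by
        by_contra h2
        have := le_top_of_mem_support hp hc ((mem_support_iff hp).mpr h2)
        rw [← hak] at this; exact (not_le.mpr hlt) this
      rw [h1, h2, mul_zero, sub_zero]
    · apply hm
      rw [← heq, he, hak, sub_self]
  obtain ⟨hak', -⟩ := top_eq_of_rel hp hb'0 hc h'
  have hlt := hsupp _ (Finset.max'_mem (support hp b') (support_nonempty hp hb'0))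
  change top hp hb'0 < top hp hb at hlt
  rw [hak', ← hak] at hlt
  exact lt_irrefl _ hlt

/-! ### Fontaine's regularity (iii): a `Γ_F`-stable line is spanned by a unit -/

/-- **Fontaine's regularity (iii) for `B_HT`**: a non-zero `b` whose `F`-multiples form a
`Γ_F`-stable line (`σ • b = e_σ b`, `e_σ ∈ F`) is a single monomial `β T^a`, hence a unit.
[cite: FontaineAsterisque223III, Exp. III §1.4 and §1.5] [cite: FontaineOuyang2022, §5.1] -/
theorem isUnit_of_smul_eq_algebraMap_mul (b : HT hp) (hb : b ≠ 0)
    (h : ∀ σ : absoluteGaloisGroup F, ∃ e : F, σ • b = algebraMap F (HT hp) e * b) : IsUnit b := by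
  set a := top hp hb with hadef
  have hβ := coeff_top_ne_zero hp hb
  -- the support is `{a}`
  have hsupp : ∀ m ∈ support hp b, m = a := by
    intro m hm
    have hβm := (mem_support_iff hp).mp hm
    have hrel : ∀ σ : absoluteGaloisGroup F,
        σ • coeff hp b m * twist hp σ ^ m * coeff hp b a = coeff hp b m * (σ • coeff hp b a * twist hp σ ^ a) := by
      intro σ
      obtain ⟨e, he⟩ := h σ
      have hm' : σ • coeff hp b m * twist hp σ ^ m = algebraMap F (CompletedAlgClosure F) e * coeff hp b m := by
        rw [← coeff_smul, he, algebraMap_eq, coeff_mono_zero_mul]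
      have ha' : σ • coeff hp b a * twist hp σ ^ a = algebraMap F (CompletedAlgClosure F) e * coeff hp b a := by
        rw [← coeff_smul, he, algebraMap_eq, coeff_mono_zero_mul]
      rw [hm', ha']; ring
    exact (eq_and_exists_of_smul_rel hp hβm hβ hrel).1
  have hb_eq : b = mono hp (coeff hp b a) a := by
    refine ext hp fun n => ?_
    rw [coeff_mono]
    split_ifs with han
    · rw [han]
    · by_contra hne
      exact han (hsupp n ((mem_support_iff hp).mpr hne)).symm
  rw [hb_eq]
  exact ⟨monoUnit hp (Units.mk0 _ hβ) a, rfl⟩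

/-! ### Fontaine's regularity (i): `B_HT^{Γ_F} = F` -/

/-- **`B_HT^{Γ_F} = F`**: an element fixed by `Γ_F` has `b_n ∈ ℂ_F(χ^{-n})^{Γ_F} = 0` for `n ≠ 0`
(Tate) and `b_0 ∈ ℂ_F^{Γ_F} = F` (Ax–Sen–Tate). [cite: FontaineAsterisque223III, Exp. II §1.5.5]
[cite: Tate1967, §3.3 Theorem 2] -/
theorem mem_range_algebraMap_of_forall_smul_eq {b : HT hp}
    (h : ∀ σ : absoluteGaloisGroup F, σ • b = b) : b ∈ Set.range (algebraMap F (HT hp)) := by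
  have hcoeff : ∀ (σ : absoluteGaloisGroup F) (n : ℤ), σ • coeff hp b n * twist hp σ ^ n = coeff hp b n := by
    intro σ n; rw [← coeff_smul, h σ]
  -- `b_n = 0` for `n ≠ 0`
  have hzero : ∀ n, n ≠ 0 → coeff hp b n = 0 := by
    intro n hn
    refine eq_zero_of_smul_eq_twist_zpow_mul hp (neg_ne_zero.mpr hn) fun σ => ?_
    have ht : twist hp σ ≠ 0 := twist_ne_zero hp σ
    have := hcoeff σ n
    rw [zpow_neg, eq_inv_mul_iff_mul_eq₀ (zpow_ne_zero n ht), mul_comm]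
    exact this
  -- `b_0 ∈ F`
  have hfix : coeff hp b 0 ∈ {y : CompletedAlgClosure F | ∀ σ : absoluteGaloisGroup F, σ • y = y} := by
    intro σ; have := hcoeff σ 0; rwa [zpow_zero, mul_one] at this
  rw [CompletedAlgClosure.fixedPoints_eq_range_algebraMap] at hfix
  obtain ⟨e, he⟩ := hfix
  refine ⟨e, ?_⟩
  rw [algebraMap_eq, he]
  refine ext hp fun n => ?_
  rw [coeff_mono]
  split_ifs with hn
  · rw [hn]
  · exact (hzero n (Ne.symm hn)).symm

/-- The invariants of `B_HT` are exactly `F`. [cite: FontaineAsterisque223III, Exp. II §1.5.5] -/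
theorem invariants_eq :
    {b : HT hp | ∀ σ : absoluteGaloisGroup F, σ • b = b} = Set.range (algebraMap F (HT hp)) := by
  ext b
  constructor
  · exact mem_range_algebraMap_of_forall_smul_eq hp
  · rintro ⟨e, rfl⟩ σ; exact smul_algebraMap hp σ e

end HT

/-! ### The Hodge–Tate period-ring datum -/

variable [CharZero F] [Fact p.Prime]

/-- **The Hodge–Tate period ring `B_HT(F)` as a period-ring datum** for `Γ_F` over `ℚ_p` with
invariant field `F`: `B = ℂ_F[T;T⁻¹]` with `σ(c Tⁿ) = σ(c) χ_F(σ)ⁿ Tⁿ`, Fontaine's three regularity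
conditions (`B_HT^{Γ_F} = F` — Ax–Sen–Tate and Tate; `(Frac B_HT)^{Γ_F} = F`; a `Γ_F`-stable
`ℚ_p`-line is spanned by a unit — both again by Tate's theorem), and the filtration
`Fil^i = ⊕_{n ≥ i} ℂ_F Tⁿ`. This is the FIRST genuine (non-truncated) instance of the tree's
`PeriodRingData` interface: `B_HT = gr B_dR` (Fontaine 1994, Exp. II §1.5.5, Exp. III §1.5), whose
admissible representations are the Hodge–Tate ones. The `ℚ_p`-algebra structure of `F` is the
ambient instance (the canonical `LocalField.padicAlgebra` in Fontaine's datum).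
[cite: FontaineAsterisque223III, Exp. II §1.5.5 and Exp. III §1.5] [cite: Tate1967, §3.3 Theorem 2] -/
def hodgeTatePeriodRingData (hp : valuation F p < 1) [Algebra ℚ_[p] F] :
    PeriodRingData.{0, 0, 0, 0} (absoluteGaloisGroup F) ℚ_[p] F where
  B := HT hp
  invariants_eq := HT.invariants_eq hp
  exists_smul_eq := fun b c hc h => HT.exists_smul_eq hp b c hc h
  isUnit_of_smul_mem := fun b hb h =>
    HT.isUnit_of_smul_eq_algebraMap_mul hp b hb fun σ => by
      obtain ⟨c, hc⟩ := h σ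
      exact ⟨algebraMap ℚ_[p] F c, hc⟩
  fil := HT.fil hp
  fil_antitone := HT.fil_antitone hp
  mul_mem_fil := fun i j x y hx hy => HT.mul_mem_fil hp hx hy
  one_mem_fil_zero := HT.one_mem_fil_zero hp
  smul_mem_fil := fun σ i x hx => HT.smul_mem_fil hp σ hx
  iSup_fil := HT.iSup_fil hp
  iInf_fil := HT.iInf_fil hp

/-- The period ring of `hodgeTatePeriodRingData` is `B_HT = HT hp`. [folklore] -/
@[simp] theorem hodgeTatePeriodRingData_B (hp : valuation F p < 1) [Algebra ℚ_[p] F] :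
    (hodgeTatePeriodRingData hp).B = HT hp := rfl

end Literature.NumberTheory.PAdicHodge

end
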